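import Summits.HodgeConjecture.HodgeConjecture.Theorems.F0LD2ThetaTensorClasses
import Literature.NumberTheory.Automorphic.CompactSubgroupAveraging
import Mathlib.Analysis.Convex.Integral
import HarnessLib

-- As in the lineage (★ `F0LD1ThetaTransportKit`, ★ `F0LD2ThetaTensorClasses`): statements over the theta-kernel datum elaborate to very large
-- types; elaborate sequentially.
set_option Elab.async false

/-!
# Crux `HLiu418`, line LD1 — (Gβ2-iv) THE COMPACT-OPEN AVERAGE OF A THETA CLASS STAYS IN THE SPAN OF THETA CLASSES, AND FIXES
# A CLASS OF FIXED LEVEL (THEOREMS ONLY)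

Cell hodgecm-mathlib, FLOOR 0, programme-6 line LD1 (socket `stub_S1_facts`, #73 E1θhol), LD1-p01 (g2), brick (Gβ2-iv) of LD1-plan's (I′) GERM
ROAD; `--supports stmt-HodgeConjecture-24832`.  Namespace `Summit.HodgeConjecture.HodgeConjecture.Cruxes.HLiu418.F0LD1ThetaClassFiniteAverage`.
KERNEL ONLY: theorems; no definition, no named fact, no `sorry`, no instance, no notation.  Nothing of [Liu2021] is asserted; HC_CM is proved
only modulo the 7 printed citations (2 remaining: hLiu418 = stmt-HodgeConjecture-24832, h413 = stmt-HodgeConjecture-24833) until rung 0 closes;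
count-neutral.

THE POINT.  Let `K' ≤ U(H)(𝔸_{L⁺,f})` be a compact subgroup with Haar probability `dk` (★ `subgroupHaar`), `R = rightRegular ν`
the right-regular representation of `U(H)(𝔸)` on `L²([U(H)], ν)`, and `v = [Θ̃_{R_e E(Φ_∞ ⊗ Φ_f)}(f) ∘ ιA]` the class of a pure tensor (★
`F0LD2ThetaTensorClasses`).  By the finite-factor EQUIVARIANCE ★ `rightRegular_finAdelicToAdelic_toLp_lineThetaLift_tensor` (LD2-p02),
`R(k) v = [Θ̃_{R_e E(Φ_∞ ⊗ ω_f(ι_V k, 1)Φ_f)}(f) ∘ ιA]` is again a theta class of the SAME archimedean datum.  Hence (Bochner integrals in the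
Hilbert space `L²([U(H)], ν)`, written INLINE — no operator-valued averaging is imported):

* §0 two abstract lemmas: `integral_mem_of_forall_mem` — over a probability space, a Bochner integral of a function with values in a CLOSED
  submodule lies in it ([Mathlib `Convex.integral_mem`]; no integrability needed: a non-integrable integrand integrates to `0`);
  `integral_eq_of_forall_eq` — the integral of a constant function over a probability space is the constant;
* §1 `average_rightRegular_thetaClass_mem` — the `K'`-AVERAGE `∫_{K'} R(k) v dk` lies in every closed submodule of `L²([U(H)], ν)` containing the
  theta classes `[Θ̃_{R_e E(Φ_∞ ⊗ ω_f(ι_V k, 1)Φ_f)}]`, `k ∈ K'` — in particular (`average_rightRegular_thetaClass_mem_span`) in their ℂ-span as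
  soon as that span is finite-dimensional (finite-dimensional subspaces are closed), which is what (Gβ1-glue) supplies for `𝒞_{K'}`;
* §2 `average_rightRegular_eq_self_of_forall_eq` — a `K'`-FIXED vector is its own average; `average_rightRegular_thetaClass_eq_self_of_fixed` —
  if `ω_f(ι_V k, 1) Φ_f = Φ_f` for all `k ∈ K'` (LEVEL `K'`), the average of the theta class is the theta class.

HONEST SCOPE.  Measure-theoretic bookkeeping over ★ equivariance; the exact finite formula `(1∕m) Σ_i [θ_{Φ_∞ ⊗ ω_f(k_i)Φ_f}]` over coset
representatives of `K' ∩ Stab(Φ_f)` is NOT needed by the junction and not typed here.  Nothing of [Liu2021] is asserted; no book row moves.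

## References
* [BorelJacquet1979] A. Borel, H. Jacquet, *Automorphic forms and automorphic representations*, PSPM 33.1 (1979), §4.6.
* [MoeglinVignerasWaldspurger1987] C. Mœglin, M.-F. Vignéras, J.-L. Waldspurger, LNM 1291 (1987), chap. 3 IV.4.
* [Weil1964] A. Weil, Acta Math. 111 (1964), Chap. III n° 37–38 pp. 188–190, n° 41 Thm 6 p. 193.
-/

set_option autoImplicit false
-- the mandated namespace has the single-problem summit's repeated segment (`HodgeConjecture.HodgeConjecture`)
set_option linter.dupNamespace false

noncomputable section

open NumberField MeasureTheory IsDedekindDomain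
open scoped Matrix Kronecker ComplexOrder ENNReal SchwartzMap TensorProduct Classical


open _root_.MeasureTheory
open Literature.NumberTheory.Automorphic Literature.NumberTheory.Automorphic.UnitaryGroup
open Literature.NumberTheory.Automorphic.UnitaryGroup.CotangentForms
open Literature.NumberTheory.Automorphic.IdeleClassGroup
open Literature.NumberTheory.Automorphic.Liu2021
open Literature.NumberTheory.Automorphic.Liu2021.Def411WeilCarriers
open Literature.NumberTheory.Automorphic.Liu2021.Def411WeilCarriersDoubling
open Literature.NumberTheory.GelbartRogawski1991 Literature.NumberTheory.GelbartRogawski1991.UnitaryDualPair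
open Literature.NumberTheory.GelbartRogawski1991.UnitaryDualPair.WeilCoinv
open Literature.NumberTheory.Weil1964
open Literature.RepresentationTheory Literature.RepresentationTheory.Liu2021
open Literature.RepresentationTheory.CompactGroups
open Literature.RepresentationTheory.HeisenbergGroup
open Summit.HodgeConjecture.HodgeConjecture.Cruxes.HLiu418.F0LD1ThetaTransportKit
open scoped SchwartzMap TensorProduct Classical

namespace Summit.HodgeConjecture.HodgeConjecture.Cruxes.HLiu418.F0LD1ThetaClassFiniteAverage

open Summit.HodgeConjecture.HodgeConjecture.Cruxes.HLiu418.F0LD1ThetaTransportKit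
open Summit.HodgeConjecture.HodgeConjecture.Cruxes.HLiu418.F0LD2ThetaTensorClasses

/-! ## §0 Two abstract lemmas on Bochner integrals over a probability space -/

section Abstract

variable {α : Type*} [MeasurableSpace α] (μP : Measure α) [IsProbabilityMeasure μP]
  {X : Type*} [NormedAddCommGroup X] [NormedSpace ℂ X] [CompleteSpace X]

/-- Over a probability space, the Bochner integral of a function with values in a CLOSED ℂ-submodule lies in that submodule
(Mathlib `Convex.integral_mem`; a non-integrable integrand integrates to `0`). [folklore] -/
theorem integral_mem_of_forall_mem (V : Submodule ℂ X) (hV : IsClosed (V : Set X)) {F : α → X} (hF : ∀ x, F x ∈ V) :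
    ∫ x, F x ∂μP ∈ V := by
  by_cases hFi : Integrable F μP
  · have hconv : Convex ℝ (V : Set X) := (V.restrictScalars ℝ).convex
    exact hconv.integral_mem hV (Filter.Eventually.of_forall hF) hFi
  · rw [integral_undef hFi]
    exact V.zero_mem

/-- Over a probability space, the Bochner integral of a constant function is the constant. [folklore] -/
theorem integral_eq_of_forall_eq {F : α → X} {v : X} (hF : ∀ x, F x = v) : ∫ x, F x ∂μP = v := by
  rw [show F = fun _ => v from funext hF, integral_const, probReal_univ, one_smul]

end Abstract

/-! ## §1 The `K'`-average of a theta class lies in the span of theta classes -/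

section Theta

variable (L : Type) [Field L] [NumberField L] [IsCMField L] (N : ℕ) (H : Matrix (Fin N) (Fin N) L)
  {n' : ℕ} (e₁ : Fin N × Fin 1 ≃ Fin n') (dV : Fin N → L) (hdV : ∀ i, IsCMField.complexConj L (dV i) = dV i)
  (hdV0 : ∀ i, dV i ≠ 0)
  (ιA : (adelicGroupData (↥(maximalRealSubfield L)) L (IsCMField.complexConj L) N H).Adelic →* ↥(UnitaryGroup.adelic (↥(maximalRealSubfield L)) L (IsCMField.complexConj L) N (Matrix.diagonal dV)))
  (hιA : Continuous ιA ∧ ∀ ⦃γ : (adelicGroupData (↥(maximalRealSubfield L)) L (IsCMField.complexConj L) N H).Adelic⦄,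
    γ ∈ (UnitaryGroup.toAdelic (↥(maximalRealSubfield L)) L (IsCMField.complexConj L) N H).range →
      ιA γ ∈ (UnitaryGroup.toAdelic (↥(maximalRealSubfield L)) L (IsCMField.complexConj L) N (Matrix.diagonal dV)).range)
  (μ : Literature.NumberTheory.Automorphic.IdeleClassGroup L →ₜ* Circle) (hμ : IsConjugateSymplectic L μ) (a : (↥(maximalRealSubfield L))ˣ)
  (hρ : HasThetaMajorants fun
      (p : ↥(UnitaryGroup.adelic (↥(maximalRealSubfield L)) L (IsCMField.complexConj L) N (Matrix.diagonal dV)) × ↥(UnitaryGroup.adelic (↥(maximalRealSubfield L)) L (IsCMField.complexConj L) 1 (JW (↥(maximalRealSubfield L)) L a))) (Φ : piSchwartzBruhat (↥(maximalRealSubfield L)) (Fin n')) =>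
        pairRep (↥(maximalRealSubfield L)) L (IsCMField.complexConj L) N 1 e₁ (Matrix.diagonal dV) (JW (↥(maximalRealSubfield L)) L a)
          (chiSplittingLine L e₁ dV hdV hdV0 (toHeckeCharacter L μ) (isUnitary_toHeckeCharacter L μ)
            ((isOscillatorChar_toHeckeCharacter_iff μ).mpr hμ) (TW (↥(maximalRealSubfield L)) a)
            (isUnit_det_TW (↥(maximalRealSubfield L)) a) (JW (↥(maximalRealSubfield L)) L a) (JW_eq (↥(maximalRealSubfield L)) L a))
          p Φ)
  [CompactSpace (↥(UnitaryGroup.adelic (↥(maximalRealSubfield L)) L (IsCMField.complexConj L) N (Matrix.diagonal dV)) ⧸ (UnitaryGroup.toAdelic (↥(maximalRealSubfield L)) L (IsCMField.complexConj L) N (Matrix.diagonal dV)).range)] [MeasurableSpace (↥(UnitaryGroup.adelic (↥(maximalRealSubfield L)) L (IsCMField.complexConj L) 1 (JW (↥(maximalRealSubfield L)) L a)) ⧸ (UnitaryGroup.toAdelic (↥(maximalRealSubfield L)) L (IsCMField.complexConj L) 1 (JW (↥(maximalRealSubfield L)) L a)).range)] (μW : Measure (↥(UnitaryGroup.adelic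 (↥(maximalRealSubfield L)) L (IsCMField.complexConj L) 1 (JW (↥(maximalRealSubfield L)) L a)) ⧸ (UnitaryGroup.toAdelic (↥(maximalRealSubfield L)) L (IsCMField.complexConj L) 1 (JW (↥(maximalRealSubfield L)) L a)).range))
  (f : C((↥(UnitaryGroup.adelic (↥(maximalRealSubfield L)) L (IsCMField.complexConj L) 1 (JW (↥(maximalRealSubfield L)) L a)) ⧸ (UnitaryGroup.toAdelic (↥(maximalRealSubfield L)) L (IsCMField.complexConj L) 1 (JW (↥(maximalRealSubfield L)) L a)).range), ℂ))
  (φ : 𝓢(((Fin N × Fin 1) → NumberField.mixedEmbedding.mixedSpace ↥(maximalRealSubfield L)), ℂ))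
  [CompactSpace (adelicGroupData (↥(maximalRealSubfield L)) L (IsCMField.complexConj L) N H).automorphicQuotient]
  (ν : Measure (adelicGroupData (↥(maximalRealSubfield L)) L (IsCMField.complexConj L) N H).automorphicQuotient) [IsFiniteMeasure ν]

variable [BorelSpace (↥(UnitaryGroup.adelic (↥(maximalRealSubfield L)) L (IsCMField.complexConj L) 1 (JW (↥(maximalRealSubfield L)) L a)) ⧸ (UnitaryGroup.toAdelic (↥(maximalRealSubfield L)) L (IsCMField.complexConj L) 1 (JW (↥(maximalRealSubfield L)) L a)).range)] [IsFiniteMeasure μW]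
variable [SMulInvariantMeasure (adelicGroupData (↥(maximalRealSubfield L)) L (IsCMField.complexConj L) N H).Adelic (adelicGroupData (↥(maximalRealSubfield L)) L (IsCMField.complexConj L) N H).automorphicQuotient ν]
  [MeasurableSpace (finAdelic (↥(maximalRealSubfield L)) L (IsCMField.complexConj L) N H)] [BorelSpace (finAdelic (↥(maximalRealSubfield L)) L (IsCMField.complexConj L) N H)]

include hιA in
/-- **(Gβ2-iv) The compact average of a theta class stays among theta classes**: for a compact subgroup `K' ≤ U(H)(𝔸_{L⁺,f})` with Haar
probability `dk` and every CLOSED submodule `V ≤ L²([U(H)], ν)` containing the classes `[Θ̃_{R_e E(Φ_∞ ⊗ ω_f(ι_V k, 1)Φ_f)}(f) ∘ ιA]`, `k ∈ K'`,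
the average `∫_{K'} R(k) [Θ̃_{R_e E(Φ_∞ ⊗ Φ_f)}(f) ∘ ιA] dk` lies in `V` (★ `rightRegular_finAdelicToAdelic_toLp_lineThetaLift_tensor`, §0).
[cite: BorelJacquet1979, §4.6] [cite: MoeglinVignerasWaldspurger1987, chap. 3 IV.4] -/
theorem average_rightRegular_thetaClass_mem
    (hιAf : ∀ k, ιA (finAdelicToAdelic (↥(maximalRealSubfield L)) L (IsCMField.complexConj L) N H k) =
      finAdelicToAdelic (↥(maximalRealSubfield L)) L (IsCMField.complexConj L) N (Matrix.diagonal dV)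
        (finPart (↥(maximalRealSubfield L)) L (IsCMField.complexConj L) N (Matrix.diagonal dV)
          (ιA (finAdelicToAdelic (↥(maximalRealSubfield L)) L (IsCMField.complexConj L) N H k))))
    (K' : Subgroup (finAdelic (↥(maximalRealSubfield L)) L (IsCMField.complexConj L) N H)) (hK' : IsCompact (K' : Set (finAdelic (↥(maximalRealSubfield L)) L (IsCMField.complexConj L) N H)))
    (Φf : FinSB (↥(maximalRealSubfield L)) (Fin N × Fin 1))
    (V : Submodule ℂ (Lp ℂ 2 (ν : Measure (adelicGroupData (↥(maximalRealSubfield L)) L (IsCMField.complexConj L) N H).automorphicQuotient))) (hV : IsClosed (V : Set (Lp ℂ 2 (ν : Measure (adelicGroupData (↥(maximalRealSubfield L)) L (IsCMField.complexConj L) N H).automorphicQuotient))))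
    (hmem : ∀ k : (finAdelic (↥(maximalRealSubfield L)) L (IsCMField.complexConj L) N H), k ∈ K' →
      MemLp.toLp _ (memLp_toQuotFun_lineThetaLift L N H e₁ dV hdV hdV0 ιA hιA μ hμ a hρ μW
        (piSBReindex (↥(maximalRealSubfield L)) e₁ (piSchwartzBruhatEquiv (↥(maximalRealSubfield L)) (Fin N × Fin 1)
          (φ ⊗ₜ[ℂ] finPairRep (↥(maximalRealSubfield L)) L (IsCMField.complexConj L) N 1 e₁ (Matrix.diagonal dV) (JW (↥(maximalRealSubfield L)) L a)
            (complexConj_imagUnit L) (imagUnit_ne_zero L) (imagUnit_mul_self L) (realDiagonal_isSymm L dV hdV) (isSymm_TW (↥(maximalRealSubfield L)) a)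
            (isUnit_det_realDiagonal L dV hdV hdV0) (isUnit_det_TW (↥(maximalRealSubfield L)) a) (realDiagonal_map L dV hdV).symm
            (JW_eq (↥(maximalRealSubfield L)) L a)
            (isCompatible_chiSplittingLine L e₁ dV hdV hdV0 (toHeckeCharacter L μ) (isUnitary_toHeckeCharacter L μ)
              ((isOscillatorChar_toHeckeCharacter_iff μ).mpr hμ) (TW (↥(maximalRealSubfield L)) a) (isSymm_TW (↥(maximalRealSubfield L)) a)
              (isUnit_det_TW (↥(maximalRealSubfield L)) a) (JW (↥(maximalRealSubfield L)) L a) (JW_eq (↥(maximalRealSubfield L)) L a))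
            ((finPart (↥(maximalRealSubfield L)) L (IsCMField.complexConj L) N (Matrix.diagonal dV)
              (ιA (finAdelicToAdelic (↥(maximalRealSubfield L)) L (IsCMField.complexConj L) N H (k : finAdelic (↥(maximalRealSubfield L)) L (IsCMField.complexConj L) N H)))), 1) Φf))) f ν 2) ∈ V) :
    ∫ k : ↥K', (adelicGroupData (↥(maximalRealSubfield L)) L (IsCMField.complexConj L) N H).rightRegular ν (finAdelicToAdelic (↥(maximalRealSubfield L)) L (IsCMField.complexConj L) N H (k : finAdelic (↥(maximalRealSubfield L)) L (IsCMField.complexConj L) N H))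
        (MemLp.toLp _ (memLp_toQuotFun_lineThetaLift L N H e₁ dV hdV hdV0 ιA hιA μ hμ a hρ μW
          (piSBReindex (↥(maximalRealSubfield L)) e₁ (piSchwartzBruhatEquiv (↥(maximalRealSubfield L)) (Fin N × Fin 1) (φ ⊗ₜ[ℂ] Φf))) f ν 2)) ∂(subgroupHaar K' hK') ∈ V := by
  refine integral_mem_of_forall_mem _ V hV fun k => ?_
  rw [F0LD2ThetaTensorClasses.rightRegular_finAdelicToAdelic_toLp_lineThetaLift_tensor L N H e₁ dV hdV hdV0 ιA hιA μ hμ a hρ μW f φ ν hιAf (k : finAdelic (↥(maximalRealSubfield L)) L (IsCMField.complexConj L) N H) Φf]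
  exact hmem k k.2

include hιA in
/-- **(Gβ2-iv), span form**: if the ℂ-span of the classes `[Θ̃_{R_e E(Φ_∞ ⊗ ω_f(ι_V k, 1)Φ_f)}(f) ∘ ιA]`, `k ∈ K'`, lies in a FINITE-DIMENSIONAL
submodule `W` (so `W` is closed), the `K'`-average of `[Θ̃_{R_e E(Φ_∞ ⊗ Φ_f)}(f) ∘ ιA]` lies in `W`. [cite: BorelJacquet1979, §4.6] -/
theorem average_rightRegular_thetaClass_mem_of_finiteDimensional
    (hιAf : ∀ k, ιA (finAdelicToAdelic (↥(maximalRealSubfield L)) L (IsCMField.complexConj L) N H k) =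
      finAdelicToAdelic (↥(maximalRealSubfield L)) L (IsCMField.complexConj L) N (Matrix.diagonal dV)
        (finPart (↥(maximalRealSubfield L)) L (IsCMField.complexConj L) N (Matrix.diagonal dV)
          (ιA (finAdelicToAdelic (↥(maximalRealSubfield L)) L (IsCMField.complexConj L) N H k))))
    (K' : Subgroup (finAdelic (↥(maximalRealSubfield L)) L (IsCMField.complexConj L) N H)) (hK' : IsCompact (K' : Set (finAdelic (↥(maximalRealSubfield L)) L (IsCMField.complexConj L) N H)))
    (Φf : FinSB (↥(maximalRealSubfield L)) (Fin N × Fin 1))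
    (W : Submodule ℂ (Lp ℂ 2 (ν : Measure (adelicGroupData (↥(maximalRealSubfield L)) L (IsCMField.complexConj L) N H).automorphicQuotient))) [FiniteDimensional ℂ W]
    (hmem : ∀ k : (finAdelic (↥(maximalRealSubfield L)) L (IsCMField.complexConj L) N H), k ∈ K' →
      MemLp.toLp _ (memLp_toQuotFun_lineThetaLift L N H e₁ dV hdV hdV0 ιA hιA μ hμ a hρ μW
        (piSBReindex (↥(maximalRealSubfield L)) e₁ (piSchwartzBruhatEquiv (↥(maximalRealSubfield L)) (Fin N × Fin 1)
          (φ ⊗ₜ[ℂ] finPairRep (↥(maximalRealSubfield L)) L (IsCMField.complexConj L) N 1 e₁ (Matrix.diagonal dV) (JW (↥(maximalRealSubfield L)) L a)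
            (complexConj_imagUnit L) (imagUnit_ne_zero L) (imagUnit_mul_self L) (realDiagonal_isSymm L dV hdV) (isSymm_TW (↥(maximalRealSubfield L)) a)
            (isUnit_det_realDiagonal L dV hdV hdV0) (isUnit_det_TW (↥(maximalRealSubfield L)) a) (realDiagonal_map L dV hdV).symm
            (JW_eq (↥(maximalRealSubfield L)) L a)
            (isCompatible_chiSplittingLine L e₁ dV hdV hdV0 (toHeckeCharacter L μ) (isUnitary_toHeckeCharacter L μ)
              ((isOscillatorChar_toHeckeCharacter_iff μ).mpr hμ) (TW (↥(maximalRealSubfield L)) a) (isSymm_TW (↥(maximalRealSubfield L)) a)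
              (isUnit_det_TW (↥(maximalRealSubfield L)) a) (JW (↥(maximalRealSubfield L)) L a) (JW_eq (↥(maximalRealSubfield L)) L a))
            ((finPart (↥(maximalRealSubfield L)) L (IsCMField.complexConj L) N (Matrix.diagonal dV)
              (ιA (finAdelicToAdelic (↥(maximalRealSubfield L)) L (IsCMField.complexConj L) N H (k : finAdelic (↥(maximalRealSubfield L)) L (IsCMField.complexConj L) N H)))), 1) Φf))) f ν 2) ∈ W) :
    ∫ k : ↥K', (adelicGroupData (↥(maximalRealSubfield L)) L (IsCMField.complexConj L) N H).rightRegular ν (finAdelicToAdelic (↥(maximalRealSubfield L)) L (IsCMField.complexConj L) N H (k : finAdelic (↥(maximalRealSubfield L)) L (IsCMField.complexConj L) N H))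
        (MemLp.toLp _ (memLp_toQuotFun_lineThetaLift L N H e₁ dV hdV hdV0 ιA hιA μ hμ a hρ μW
          (piSBReindex (↥(maximalRealSubfield L)) e₁ (piSchwartzBruhatEquiv (↥(maximalRealSubfield L)) (Fin N × Fin 1) (φ ⊗ₜ[ℂ] Φf))) f ν 2)) ∂(subgroupHaar K' hK') ∈ W :=
  average_rightRegular_thetaClass_mem L N H e₁ dV hdV hdV0 ιA hιA μ hμ a hρ μW f φ ν hιAf K' hK' Φf W W.closed_of_finiteDimensional hmem

/-! ## §2 A class of level `K'` is its own `K'`-average -/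

omit [CompactSpace (adelicGroupData (↥(maximalRealSubfield L)) L (IsCMField.complexConj L) N H).automorphicQuotient] [IsFiniteMeasure ν] in
/-- **A `K'`-fixed vector is its own `K'`-average** (the integrand is constant; Haar probability). [cite: BorelJacquet1979, §4.6] -/
theorem average_rightRegular_eq_self_of_forall_eq
    (K' : Subgroup (finAdelic (↥(maximalRealSubfield L)) L (IsCMField.complexConj L) N H)) (hK' : IsCompact (K' : Set (finAdelic (↥(maximalRealSubfield L)) L (IsCMField.complexConj L) N H)))
    (v : Lp ℂ 2 (ν : Measure (adelicGroupData (↥(maximalRealSubfield L)) L (IsCMField.complexConj L) N H).automorphicQuotient))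
    (hfix : ∀ k : (finAdelic (↥(maximalRealSubfield L)) L (IsCMField.complexConj L) N H), k ∈ K' → (adelicGroupData (↥(maximalRealSubfield L)) L (IsCMField.complexConj L) N H).rightRegular ν (finAdelicToAdelic (↥(maximalRealSubfield L)) L (IsCMField.complexConj L) N H k) v = v) :
    ∫ k : ↥K', (adelicGroupData (↥(maximalRealSubfield L)) L (IsCMField.complexConj L) N H).rightRegular ν (finAdelicToAdelic (↥(maximalRealSubfield L)) L (IsCMField.complexConj L) N H (k : finAdelic (↥(maximalRealSubfield L)) L (IsCMField.complexConj L) N H)) v ∂(subgroupHaar K' hK') = v :=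
  integral_eq_of_forall_eq _ fun k => hfix k k.2

include hιA in
/-- **(Gβ2-iv), fixed level**: if `ω_f(ι_V k, 1) Φ_f = Φ_f` for every `k ∈ K'`, the `K'`-average of `[Θ̃_{R_e E(Φ_∞ ⊗ Φ_f)}(f) ∘ ιA]` is the
class itself (★ equivariance + constancy). [cite: BorelJacquet1979, §4.6] [cite: Weil1964, Chap. III n° 37–38 pp. 188–190] -/
theorem average_rightRegular_thetaClass_eq_self_of_fixed
    (hιAf : ∀ k, ιA (finAdelicToAdelic (↥(maximalRealSubfield L)) L (IsCMField.complexConj L) N H k) =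
      finAdelicToAdelic (↥(maximalRealSubfield L)) L (IsCMField.complexConj L) N (Matrix.diagonal dV)
        (finPart (↥(maximalRealSubfield L)) L (IsCMField.complexConj L) N (Matrix.diagonal dV)
          (ιA (finAdelicToAdelic (↥(maximalRealSubfield L)) L (IsCMField.complexConj L) N H k))))
    (K' : Subgroup (finAdelic (↥(maximalRealSubfield L)) L (IsCMField.complexConj L) N H)) (hK' : IsCompact (K' : Set (finAdelic (↥(maximalRealSubfield L)) L (IsCMField.complexConj L) N H)))
    (Φf : FinSB (↥(maximalRealSubfield L)) (Fin N × Fin 1))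
    (hfix : ∀ k : (finAdelic (↥(maximalRealSubfield L)) L (IsCMField.complexConj L) N H), k ∈ K' →
      finPairRep (↥(maximalRealSubfield L)) L (IsCMField.complexConj L) N 1 e₁ (Matrix.diagonal dV) (JW (↥(maximalRealSubfield L)) L a)
            (complexConj_imagUnit L) (imagUnit_ne_zero L) (imagUnit_mul_self L) (realDiagonal_isSymm L dV hdV) (isSymm_TW (↥(maximalRealSubfield L)) a)
            (isUnit_det_realDiagonal L dV hdV hdV0) (isUnit_det_TW (↥(maximalRealSubfield L)) a) (realDiagonal_map L dV hdV).symm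
            (JW_eq (↥(maximalRealSubfield L)) L a)
            (isCompatible_chiSplittingLine L e₁ dV hdV hdV0 (toHeckeCharacter L μ) (isUnitary_toHeckeCharacter L μ)
              ((isOscillatorChar_toHeckeCharacter_iff μ).mpr hμ) (TW (↥(maximalRealSubfield L)) a) (isSymm_TW (↥(maximalRealSubfield L)) a)
              (isUnit_det_TW (↥(maximalRealSubfield L)) a) (JW (↥(maximalRealSubfield L)) L a) (JW_eq (↥(maximalRealSubfield L)) L a))
            ((finPart (↥(maximalRealSubfield L)) L (IsCMField.complexConj L) N (Matrix.diagonal dV)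
              (ιA (finAdelicToAdelic (↥(maximalRealSubfield L)) L (IsCMField.complexConj L) N H k))), 1) Φf = Φf) :
    ∫ k : ↥K', (adelicGroupData (↥(maximalRealSubfield L)) L (IsCMField.complexConj L) N H).rightRegular ν (finAdelicToAdelic (↥(maximalRealSubfield L)) L (IsCMField.complexConj L) N H (k : finAdelic (↥(maximalRealSubfield L)) L (IsCMField.complexConj L) N H))
        (MemLp.toLp _ (memLp_toQuotFun_lineThetaLift L N H e₁ dV hdV hdV0 ιA hιA μ hμ a hρ μW
          (piSBReindex (↥(maximalRealSubfield L)) e₁ (piSchwartzBruhatEquiv (↥(maximalRealSubfield L)) (Fin N × Fin 1) (φ ⊗ₜ[ℂ] Φf))) f ν 2)) ∂(subgroupHaar K' hK') =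
      (MemLp.toLp _ (memLp_toQuotFun_lineThetaLift L N H e₁ dV hdV hdV0 ιA hιA μ hμ a hρ μW
          (piSBReindex (↥(maximalRealSubfield L)) e₁ (piSchwartzBruhatEquiv (↥(maximalRealSubfield L)) (Fin N × Fin 1) (φ ⊗ₜ[ℂ] Φf))) f ν 2)) := by
  refine average_rightRegular_eq_self_of_forall_eq L N H ν K' hK' _ fun k hk => ?_
  rw [F0LD2ThetaTensorClasses.rightRegular_finAdelicToAdelic_toLp_lineThetaLift_tensor L N H e₁ dV hdV hdV0 ιA hιA μ hμ a hρ μW f φ ν hιAf k Φf, hfix k hk]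

end Theta

end Summit.HodgeConjecture.HodgeConjecture.Cruxes.HLiu418.F0LD1ThetaClassFiniteAverage

end
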